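import Literature.Geometry.ComplexAnalytic.RelativeExponentialFibreUniformisation     -- ★ (D3) `exists_fibre_uniformisation_immersion` (p849174) + P-1 prefix currency
import Literature.NumberTheory.Transcendental.AnalytificationMorphismSmooth            -- ★ `IsAnalytification.contMDiff_comp_map`, `bijective_mfderiv_comp_map_of_etale` (p849091)
import Literature.AlgebraicGeometry.AbelianSchemes.AbelianSchemeOverMulNEtale            -- ★ `AbelianSchemeOver.etale_pow_id_left_of_charZero`
import Literature.AlgebraicGeometry.AbelianSchemes.AbelianSchemeTotalSpaceSmoothProjective -- ★ `AbelianSchemeOver.smoothOfRelativeDimension_total`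
import Literature.AlgebraicGeometry.AbelianSchemes.AbelianSchemeDualTransportUnit         -- ★ `DualPair.fibrePointToLeft_one`
import Literature.AlgebraicGeometry.AbelianSchemes.IsLambdaOfAtAlongIsogeny               -- ★ `fibrePointToLeft_pow`
import Literature.Geometry.Kaehler.ComplexTorusAverage                                     -- ★ `ComplexTorus.cover_add`, `proj_zero`
import HarnessLib

/-!
# The relative doubling datum of an analytified abelian scheme: `[2]^an`, the zero section, and doubling-equivariant
# fibre uniformisations ([MumfordAV1970] §1, §4 (iv), §6 App.; [BLRNeronModels1990] §7.3 Lemma 2 (b); [SerreGAGA1956] §2 n°5)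

Topic `Geometry/ComplexAnalytic`; namespace `Literature.Geometry.ComplexAnalytic` (next to ★ `RelativeExponentialUniformisation`,
★ `RelativeExponentialFibreUniformisation`, ★ `DoublingChartExtension`).  THEOREMS ONLY (no definition, no named fact, no instance, no
notation, no `sorry`).  Cell `hodgecm-mathlib` (D-0151), FLOOR 0, P6 «MOD», crux `stmt-HodgeConjecture-24832` (hLiu418), L8-PREP road B
(«DOUBLING ∕ KOENIGS») for the printed residue P-1 `relativeExponentialUniformisation` ([DeligneHodgeII1971] (4.4.2)): organ B1 `DOUBLING`
of LA7-plan (g2)՚s skeleton `StubFLOW.roadB` AS A LITERATURE THEOREM (deal (E1a) 2026-09-02T04:39:54Z; the HOME assembly by A-p15 (g19),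
folded as `section B1Assembly` of skeleton ED. 4∕5, with its hypothesis (D3) discharged by ★ `exists_fibre_uniformisation_immersion`).
`--supports stmt-HodgeConjecture-24832`, count-neutral: HC_CM is proved only modulo the printed citations (2 remaining named inputs
hLiu418 24832, h413 24833) until rung 0 closes; this file is generic and moves no digit.

THE MATHEMATICS.  Let `S` be a smooth separated `ℂ`-scheme of dimension `d`, `A → S` an abelian scheme of relative dimension `g`, and
`φS : MS → S(ℂ)`, `φA : MA → A(ℂ)` analytifications with holomorphic atlases (★ `IsAnalytification`; `A(ℂ)` = the complex points of the total
space `A → S → Spec ℂ`, ★ `totalOver`).  Multiplication by two `[2] : A → A` is an `S`-endomorphism, ÉTALE because `2` is invertible on `S`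
([MumfordAV1970] §6 App. 3 on fibres + fibrewise flatness, [BLRNeronModels1990] §7.3 Lemma 2 (b); ★ `etale_pow_id_left_of_charZero`), and the
identity section `ε : S → A` is a morphism over `S`.  By GAGA functoriality ([SerreGAGA1956] §2 n°5 Prop. 2; ★ `IsAnalytification.contMDiff_comp_map`)
their analytifications `two := φA⁻¹ ∘ [2](ℂ) ∘ φA : MA → MA` and `zero := φA⁻¹ ∘ ε(ℂ) ∘ φS : MS → MA` are `C^ω`; they lie over the analytic
projection `basePoint : MA → MS`, `two ∘ zero = zero` (`[2] ∘ ε = ε`), and `two` has BIJECTIVE differential everywhere (analytified étale maps are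
local biholomorphisms, ★ `bijective_mfderiv_comp_map_of_etale`).  Over every `u ∈ MS` the fibre `A_{φS u}` is uniformised by a doubling-free datum
(★ `exists_fibre_uniformisation_immersion`: `π : ℂ^g → MA` holomorphic immersion over `u`, kernel exactly a lattice, onto the fibre, reading an
additive analytification `φu` of `A_{φS u}`), and the two remaining clauses follow from that reading: `π 0 = zero u` (`φu 0 = 1`, ★
`DualPair.fibrePointToLeft_one`) and `two (π z) = π (2 • z)` (`φu` additive, ★ `fibrePointToLeft_pow`).

* **`exists_relative_doubling_datum`** — THE HEAD: the body of `RoadB.DOUBLING` (skeleton ED. 5 8d65a6cd) after its prefix, token for token.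

## References
* [MumfordAV1970] D. Mumford, *Abelian Varieties* (1970), §1 (1)–(2); §4 (iv); §6 Application 3.
* [BLRNeronModels1990] S. Bosch, W. Lütkebohmert, M. Raynaud, *Néron Models* (1990), §7.3 Lemma 2 (b).
* [SerreGAGA1956] J.-P. Serre, *Géométrie algébrique et géométrie analytique*, Ann. Inst. Fourier 6 (1956), §2 n°5 Prop. 2.
* [DeligneHodgeII1971] P. Deligne, *Théorie de Hodge II*, Publ. Math. IHÉS 40 (1971), §4.4 (4.4.2) p. 50.
-/

set_option autoImplicit false

noncomputable section

open scoped Manifold ContDiff Topology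
open Set Function CategoryTheory CategoryTheory.Limits AlgebraicGeometry MonoidalCategory
open scoped MonObj
open Literature.Geometry.Kaehler (ComplexTorus)
open Literature.Geometry.Kaehler.ComplexTorus (cover)
open Literature.NumberTheory.Transcendental (IsAnalytification)
open Literature.AlgebraicGeometry.Motives (SchemeOver AlgPoints ComplexPoints)
open Literature.AlgebraicGeometry.AbelianSchemes (AbelianSchemeOver)

namespace Literature.Geometry.ComplexAnalytic

/-- **THE RELATIVE DOUBLING DATUM** ([MumfordAV1970] §1, §4 (iv), §6 App. 3; [BLRNeronModels1990] §7.3 Lemma 2 (b); [SerreGAGA1956] §2 n°5).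
For a smooth separated `ℂ`-scheme `S` of dimension `d`, an abelian scheme `A → S` of relative dimension `g` and analytifications `φS`, `φA` of `S`
and of the total space: there are the analytified doubling map `two : MA → MA` and identity section `zero : MS → MA` — `C^ω`, over `basePoint`,
`two ∘ zero = zero`, `two` with bijective differential everywhere (`[2]` is étale in characteristic `0`) — and, for every `u : MS`, a fibre
uniformisation `π : ℂ^g → MA`: holomorphic with injective differential, `π 0 = zero u`, over `u`, kernel EXACTLY a full lattice `Φ₀ (ℤ^{2g})`, onto
`basePoint⁻¹ u`, DOUBLING-EQUIVARIANT `two (π z) = π (2 • z)`, reading an additive analytification `φu` of the algebraic fibre through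
`fibrePointToLeft` — the body of organ B1 `RoadB.DOUBLING` of the L8-PREP road B, token for token.
[cite: MumfordAV1970, §1 (1)–(2); §4 (iv); §6 App.] [cite: BLRNeronModels1990, §7.3 Lemma 2 (b)] [cite: SerreGAGA1956, §2 n°5 Prop. 2] -/
theorem exists_relative_doubling_datum
    (S : SchemeOver ℂ) (d : ℕ) [LocallyOfFiniteType S.hom] [IsSeparated S.hom] [SmoothOfRelativeDimension d S.hom]
    (A : AbelianSchemeOver S.left) (g : ℕ) (hA : A.IsOfRelDim g)
    (MS : Type) [TopologicalSpace MS] [ChartedSpace (Fin d → ℂ) MS] [IsManifold 𝓘(ℂ, Fin d → ℂ) ω MS]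
    (φS : MS → ComplexPoints S) (hS : IsAnalytification (Fin d → ℂ) S d φS)
    (MA : Type) [TopologicalSpace MA] [ChartedSpace (Fin (d + g) → ℂ) MA] [IsManifold 𝓘(ℂ, Fin (d + g) → ℂ) ω MA]
    (φA : MA → ComplexPoints (totalOver S A)) (hφA : IsAnalytification (Fin (d + g) → ℂ) (totalOver S A) (d + g) φA) :
    ∃ (two : MA → MA) (zero : MS → MA),
      ContMDiff 𝓘(ℂ, Fin (d + g) → ℂ) 𝓘(ℂ, Fin (d + g) → ℂ) ω two ∧
      ContMDiff 𝓘(ℂ, Fin d → ℂ) 𝓘(ℂ, Fin (d + g) → ℂ) ω zero ∧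
      (∀ a : MA, basePoint hS A φA (two a) = basePoint hS A φA a) ∧
      (∀ u : MS, basePoint hS A φA (zero u) = u) ∧
      (∀ u : MS, two (zero u) = zero u) ∧
      (∀ a : MA, Bijective (mfderiv 𝓘(ℂ, Fin (d + g) → ℂ) 𝓘(ℂ, Fin (d + g) → ℂ) two a)) ∧
      ∀ u : MS, ∃ (Φ₀ : (Fin g ⊕ Fin g → ℝ) ≃L[ℝ] (Fin g → ℂ)) (π : (Fin g → ℂ) → MA)
          (φu : ComplexTorus Φ₀ → (A.fibre (φS u).left).toAbelianVariety.Points ℂ),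
        MDifferentiable 𝓘(ℂ, Fin g → ℂ) 𝓘(ℂ, Fin (d + g) → ℂ) π ∧
        (∀ z : Fin g → ℂ, Injective (mfderiv 𝓘(ℂ, Fin g → ℂ) 𝓘(ℂ, Fin (d + g) → ℂ) π z)) ∧
        π 0 = zero u ∧
        (∀ z : Fin g → ℂ, basePoint hS A φA (π z) = u) ∧
        (∀ z z' : Fin g → ℂ, π z = π z' ↔ ∃ k : Fin g ⊕ Fin g → ℤ, z' = z + Φ₀ (fun i => (k i : ℝ))) ∧
        (∀ a : MA, basePoint hS A φA a = u → ∃ z : Fin g → ℂ, π z = a) ∧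
        (∀ z : Fin g → ℂ, two (π z) = π ((2 : ℂ) • z)) ∧
        IsAnalytification (Fin g → ℂ) (A.fibre (φS u).left).toAbelianVariety.X g φu ∧
        (∀ x y, φu (x + y) = φu x * φu y) ∧
        ∀ z : Fin g → ℂ, (φA (π z)).left = A.fibrePointToLeft (φS u).left (φu (cover Φ₀ z)) := by
  classical
  -- instances on the total space `A → S → Spec ℂ`
  haveI : SmoothOfRelativeDimension (d + g) (totalOver S A).hom := A.smoothOfRelativeDimension_total hA
  haveI : Smooth (totalOver S A).hom := SmoothOfRelativeDimension.smooth (d + g) _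
  haveI : LocallyOfFiniteType (totalOver S A).hom := inferInstance
  -- `[2]` and the identity section as `ℂ`-morphisms of the total space
  let dbl : totalOver S A ⟶ totalOver S A :=
    Over.homMk (((𝟙 A.X : A.X ⟶ A.X) ^ 2) : A.X ⟶ A.X).left (by
      change (((𝟙 A.X : A.X ⟶ A.X) ^ 2) : A.X ⟶ A.X).left ≫ A.X.hom ≫ S.hom = A.X.hom ≫ S.hom
      rw [← Category.assoc, Over.w])
  let e : S ⟶ totalOver S A :=
    Over.homMk (η[A.X] : 𝟙_ (Over S.left) ⟶ A.X).left (by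
      change (η[A.X] : 𝟙_ (Over S.left) ⟶ A.X).left ≫ A.X.hom ≫ S.hom = S.hom
      rw [← Category.assoc, Over.w]
      rfl)
  have hdbl_proj : dbl ≫ projOver S A = projOver S A := by
    ext : 1
    change (((𝟙 A.X : A.X ⟶ A.X) ^ 2) : A.X ⟶ A.X).left ≫ A.X.hom = A.X.hom
    exact Over.w _
  have he_proj : e ≫ projOver S A = 𝟙 S := by
    ext : 1
    change (η[A.X] : 𝟙_ (Over S.left) ⟶ A.X).left ≫ A.X.hom = 𝟙 S.left
    exact Over.w _
  -- the analytic maps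
  let two : MA → MA := hφA.homeomorph.symm ∘ AlgPoints.map dbl ∘ φA
  let zero : MS → MA := hφA.homeomorph.symm ∘ AlgPoints.map e ∘ φS
  have htwo : φA ∘ two = AlgPoints.map dbl ∘ φA := by
    funext a
    simp only [two, Function.comp_apply]
    exact hφA.homeomorph.apply_symm_apply _
  have hzero : φA ∘ zero = AlgPoints.map e ∘ φS := by
    funext u
    simp only [zero, Function.comp_apply]
    exact hφA.homeomorph.apply_symm_apply _
  have htwo' : ∀ a, φA (two a) = AlgPoints.map dbl (φA a) := fun a => congrFun htwo a
  have hzero' : ∀ u, φA (zero u) = AlgPoints.map e (φS u) := fun u => congrFun hzero u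
  -- points of the total space are determined by their underlying point
  have hext : ∀ P Q : ComplexPoints (totalOver S A), P.left = Q.left → P = Q := fun P Q h => Over.OverMorphism.ext h
  refine ⟨two, zero, IsAnalytification.contMDiff_comp_map hφA hφA dbl two htwo,
    IsAnalytification.contMDiff_comp_map hS hφA e zero hzero, ?_, ?_, ?_, ?_, ?_⟩
  · -- `two` lies over `basePoint`
    intro a
    simp only [basePoint, Function.comp_apply, htwo', ← AlgPoints.map_comp_apply, hdbl_proj]
  · -- `zero` is a section of `basePoint`
    intro u
    simp only [basePoint, Function.comp_apply, hzero', ← AlgPoints.map_comp_apply, he_proj, AlgPoints.map_id]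
    exact hS.homeomorph.symm_apply_apply u
  · -- `two ∘ zero = zero`: `[2] ∘ ε = ε` on points
    intro u
    apply hφA.homeomorph.injective
    rw [IsAnalytification.coe_homeomorph, htwo', hzero']
    apply hext
    rw [AlgPoints.map_apply, AlgPoints.map_apply, Over.comp_left, Over.comp_left]
    change ((φS u).left ≫ A.unitSection) ≫ (((𝟙 A.X : A.X ⟶ A.X) ^ 2) : A.X ⟶ A.X).left = (φS u).left ≫ A.unitSection
    have h1 := AbelianSchemeOver.DualPair.fibrePointToLeft_one (A := A) (Ω := ℂ) (φS u).left
    have h2 := A.fibrePointToLeft_pow (φS u).left (1 : (A.fibre (φS u).left).toAbelianVariety.Points ℂ) 2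
    rw [one_pow, h1] at h2
    exact h2.symm
  · -- `two` is étale: `[2]` is étale in characteristic `0`
    haveI : Etale dbl.left := A.etale_pow_id_left_of_charZero S.hom two_ne_zero
    exact fun a => IsAnalytification.bijective_mfderiv_comp_map_of_etale hφA hφA dbl two htwo a
  · -- the fibre uniformisations of (D3), with the two derived clauses
    intro u
    refine (exists_fibre_uniformisation_immersion S d A g hA MS φS hS MA φA hφA u).elim fun Φ₀ h => h.elim fun π h => h.elim fun φu hπ => ?_
    have hG := hπ.2.2.2.2.2.2.2
    have hadd := hπ.2.2.2.2.2.2.1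
    -- `φu 0 = 1`
    have hφu0 : φu 0 = 1 := by
      have h := hadd 0 0
      rw [add_zero] at h
      exact mul_eq_left.1 h.symm
    refine ⟨Φ₀, π, φu, hπ.1, hπ.2.1, ?_, hπ.2.2.1, hπ.2.2.2.1, hπ.2.2.2.2.1, ?_, hπ.2.2.2.2.2.1, hadd, hG⟩
    · -- `π 0 = zero u`
      apply hφA.homeomorph.injective
      rw [IsAnalytification.coe_homeomorph, hzero']
      apply hext
      rw [hG 0, AlgPoints.map_apply, Over.comp_left]
      change A.fibrePointToLeft (φS u).left (φu (cover Φ₀ 0)) = (φS u).left ≫ A.unitSection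
      rw [ComplexTorus.cover_apply, map_zero, ComplexTorus.proj_zero, hφu0]
      exact AbelianSchemeOver.DualPair.fibrePointToLeft_one (A := A) (Ω := ℂ) (φS u).left
    · -- `two (π z) = π (2 • z)`
      intro z
      apply hφA.homeomorph.injective
      rw [IsAnalytification.coe_homeomorph, htwo']
      apply hext
      rw [AlgPoints.map_apply, Over.comp_left, hG z, hG ((2 : ℂ) • z)]
      change A.fibrePointToLeft (φS u).left (φu (cover Φ₀ z)) ≫ (((𝟙 A.X : A.X ⟶ A.X) ^ 2) : A.X ⟶ A.X).left = _
      rw [← A.fibrePointToLeft_pow, two_smul, ComplexTorus.cover_add, hadd, pow_two]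

end Literature.Geometry.ComplexAnalytic

end
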